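import Summits.ValiantsHypothesis.ValiantsHypothesis.Theorems.ToricFixedPoints.Negative.FormDeborderingPaddedEndIffDc

/-!
# `ToricFixedPoints` / line `form_then_lift`, stub F1 at `(3,m)`, `m ≥ 4`: positive cases from `End·det₃`

`formDebordering_padded_of_mem_endOrbit_det3`: if a cubic `q` in the `3 × 3` variables lies in
`End(ℂ⁹)·det₃`, then for every `m ≥ 4` the padded form `ℓ^{m-3}·q(Y)` (lower-right block `Y`,
`ℓ = X (0,0)`) has the toric shape demanded by `stub_formDebordering` — outright, with no border
hypothesis (`End·det₃ ⇒ dc ≤ 3 ≤ m ⇒ End·det_m ⇒ toric`).  Inputs already in the tree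
(`FormDeborderingContentClasses33`, `FormDeborderingPermFamily33`): the five degenerate content classes
`x₀₀³, x₀₀²x₀₁, x₀₀x₀₁x₀₂, ⟨x₀₀²x₁₁, x₀₀x₀₁x₁₀⟩, ⟨x₀₀x₀₁x₁₂, x₀₀x₀₂x₁₁, x₀₁x₀₂x₁₀⟩` for all coefficients and
the permutation family `F_c` on the hypersurface `c_id c_A c_B + c₀₁c₀₂c₁₂ = 0`; apply the theorem
below to `contentClassᵢ_mem_endOrbit` / `permFamily_mem_endOrbit`.  With `FormDeborderingTestSpace`
(test forms are `ℓ^a·G(Y)`, `G` content-homogeneous) this settles F1 at `(3,m)` for `a = m-3` up to the `S₃ × S₃ ⋊ ℤ/2` relabelling, except for the `F_c` family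
off the hypersurface (where the question is NON-membership in the border, LMR-type).
Refuter/theory seat `val-width-5779-d1` (stmt-ValiantsHypothesis-5779).  VP ≠ VNP is not touched.
-/

open MvPolynomial Finset
open Literature.Computability.AlgebraicComplexity

namespace Summit.ValiantsHypothesis.Cruxes.ToricFixedPoints.Negative

/-- `End·det_m ⇒ dc ≤ m` (specialisation by the identity). [folklore] -/
theorem dc_le_of_mem_endOrbit_detPoly (m : ℕ) {q : MvPolynomial (Fin m × Fin m) ℂ}
    (hq : q ∈ endOrbit (Fin m × Fin m) ℂ (detPoly (Fin m) ℂ)) : determinantalComplexity q ≤ m := by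
  obtain ⟨A, hA⟩ := hq
  have h := hasDetRepr_aeval_of_linSubst_detPoly_eq m A q hA X fun p => (totalDegree_X _).le
  rw [aeval_X_left, AlgHom.id_apply] at h
  exact determinantalComplexity_le_of_hasDetRepr h

/-- Elements of `End·det_m` are forms of degree `m`. [folklore] -/
theorem isHomogeneous_of_mem_endOrbit_detPoly (m : ℕ) {q : MvPolynomial (Fin m × Fin m) ℂ}
    (hq : q ∈ endOrbit (Fin m × Fin m) ℂ (detPoly (Fin m) ℂ)) : q.IsHomogeneous m := by
  obtain ⟨A, hA⟩ := hq
  have hdet : (detPoly (Fin m) ℂ).IsHomogeneous m := by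
    simpa using (detPoly_isHomogeneous (n := Fin m) (k := ℂ))
  have h : (linSubst (Fin m × Fin m) ℂ A (detPoly (Fin m) ℂ)).IsHomogeneous m :=
    linSubst_isHomogeneous _ hdet
  exact hA ▸ h

/-- **F1 at `(3,m)`, `m ≥ 4`, for End-type cubics.**  `q ∈ End(ℂ⁹)·det₃` ⇒ `ℓ^{m-3}·q(Y)` has the
toric shape of `stub_formDebordering`'s conclusion. [folklore] -/
theorem formDebordering_padded_of_mem_endOrbit_det3 (m : ℕ) [NeZero m] (hm : 4 ≤ m)
    {q : MvPolynomial (Fin 3 × Fin 3) ℂ} (hq : q ∈ endOrbit (Fin 3 × Fin 3) ℂ (detPoly (Fin 3) ℂ)) :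
    let y : Fin 3 × Fin 3 → MvPolynomial (Fin m × Fin m) ℂ :=
      fun ab => X (⟨m - 3 + ab.1, by omega⟩, ⟨m - 3 + ab.2, by omega⟩)
    ∃ (u g : Matrix.GeneralLinearGroup (Fin m × Fin m) ℂ) (w : Fin m × Fin m → ℕ) (e : ℕ) (a : ℂ),
      a ≠ 0 ∧
      (∀ d ∈ (linSubst (Fin m × Fin m) ℂ (g : Matrix (Fin m × Fin m) (Fin m × Fin m) ℂ)
          (detPoly (Fin m) ℂ)).support, Finsupp.weight w d ≤ e) ∧
      X ((0 : Fin m), (0 : Fin m)) ^ (m - 3) * aeval y q =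
        a • linSubst (Fin m × Fin m) ℂ (u : Matrix (Fin m × Fin m) (Fin m × Fin m) ℂ)
          (MvPolynomial.weightedHomogeneousComponent w e
            (linSubst (Fin m × Fin m) ℂ (g : Matrix (Fin m × Fin m) (Fin m × Fin m) ℂ)
              (detPoly (Fin m) ℂ))) :=
  paddedBlock3_formDebordering_of_dc_le m hm (by omega) q (isHomogeneous_of_mem_endOrbit_detPoly 3 hq)
    ((dc_le_of_mem_endOrbit_detPoly 3 hq).trans (by omega))

end Summit.ValiantsHypothesis.Cruxes.ToricFixedPoints.Negative
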